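import Summits.Parity.GeneralizedHardyLittlewood.Theses.LiouvilleShiftedTables
import Summits.Parity.GeneralizedHardyLittlewood.Theorems.TableChowla.Negative.TableChowlaPretenders

/-!
# `TableChowla` (stmt-Parity-14270): every periodic `±1` symbol fails the crux's bound, at EVERY
# shift, every window exponent and every log power — rows congruent mod the period coincide

Negative lemmas for the crux `LiouvilleShiftedTables.TableChowla` (cdisprove seat, gen 3),
generalising the landed pretender refutations `not_tableChowlaFor_one` (`f ≡ 1`),
`not_tableChowlaFor_chi4` (rank one at the shift `c = 4` only) and `not_tableChowlaFor_unitChar`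
(real characters, at the shift `c = q` only) of `TableChowlaPretenders` / `TableChowlaSiegelGhost`.

MECHANISM (not rank-one factorisation but ROW CONGRUENCE): if the symbol `f` is `q`-periodic then
the rows `a` and `a' = a + jq` of the table `(f(ab+c))_{a,b}` are IDENTICAL (`a'b + c = ab + c + jqb`),
so `S_f(a,a') = Σ_b f(ab+c)² = B` for a `±1`-valued `f` (`rowCorr_eq_cols_of_periodic`); the table has
at most `q` distinct rows and `T = tr(MMᵀ)² ≥ #{(a,a') : a ≡ a' (q)}·B² ≥ x²/(8q)` at `x = m¹²`,
`A = m = 4qn` (`moment_ge_of_periodic`). Hence, for EVERY `q ≥ 1`, EVERY `q`-periodic `f` with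
`f(n)² = 1` (`n ≥ 1`), EVERY shift `c : ℤ` (zero or not), EVERY `0 < δ ≤ 1/12` and EVERY `C > 0`:
`not_tableChowlaBoundAt_of_periodic : ¬ TableChowlaBoundAt f c δ C` — the crux's bound fails at
every single parameter point, not merely somewhere (`not_tableChowlaFor_of_periodic`). Examples:
`f ≡ 1`, `f = (-1)^n`, and the completed character `χ₄⁺` (`χ₄` on odd `n`, `+1` on even `n`), which
"pretends" to be `χ₄`.

Moral for provers (sharper than gen-2's "non-pretentiousness to real characters of conductor
dividing the shift"): for every modulus `q ≤ 8(log x)^C` — dividing the shift or not — a proof must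
distinguish `n ↦ λ(n+c)` on `[1,2x]` from EVERY `q`-periodic sign pattern, i.e. spend
Siegel–Walfisz-type equidistribution of `λ` in ALL progressions of modulus `≤ (log x)^{C}` (the
one-point directions), uniformly; and any near-periodic structure of `λ` along the table at such a
modulus would be a counterexample family of exactly the shape `{(a,a') : a ≡ a' (q)}`. [folklore]
-/

namespace Summit.Parity.GeneralizedHardyLittlewood.Theorems.TableChowla.Negative

open Finset Real ArithmeticFunction
open Summit.Parity.GeneralizedHardyLittlewood.Theses

noncomputable section

variable {f : ℕ → ℝ} {c : ℤ}

/-- The crux's bound for the symbol `f` at ONE parameter point: shift `c`, window exponent `δ`,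
log-power `C` (so `TableChowlaFor f ↔ ∀ c ≠ 0, ∀ δ ∈ (0,1/12], ∀ C > 0, TableChowlaBoundAt f c δ C`). -/
def TableChowlaBoundAt (f : ℕ → ℝ) (c : ℤ) (δ C : ℝ) : Prop :=
  ∃ x₀ : ℝ, ∀ x : ℝ, x₀ ≤ x → ∀ A : ℝ, x ^ δ ≤ A → A ≤ x ^ (1 / 3 + δ) →
    moment f c x A ≤ x ^ 2 / Real.log x ^ C

/-- Quantifier bookkeeping: `TableChowlaFor` is the conjunction of its parameter points. -/
theorem tableChowlaFor_iff_boundAt :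
    TableChowlaFor f ↔ ∀ c : ℤ, c ≠ 0 → ∀ δ : ℝ, 0 < δ → δ ≤ 1 / 12 → ∀ C : ℝ, 0 < C →
      TableChowlaBoundAt f c δ C :=
  Iff.rfl

/-- ROW CONGRUENCE: for a `q`-periodic `±1`-valued symbol, two rows `a ≤ a'` with `q ∣ a' - a` have
full correlation `S_f(a,a') = B` (as soon as the table arguments are positive). -/
theorem rowCorr_eq_cols_of_periodic {q : ℕ} (hper : Function.Periodic f q)
    (hf : ∀ n, n ≠ 0 → f n ^ 2 = 1) {B a j : ℕ} (hpos : ∀ b ∈ Icc 1 B, 1 ≤ (a : ℤ) * b + c) :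
    rowCorr f c B a (a + j * q) = B := by
  unfold rowCorr
  calc ∑ b ∈ Icc 1 B, f (Int.toNat ((a : ℤ) * b + c)) * f (Int.toNat (((a + j * q : ℕ) : ℤ) * b + c))
      = ∑ b ∈ Icc 1 B, (1 : ℝ) := by
        refine sum_congr rfl fun b hb => ?_
        have h1 := hpos b hb
        have h0 : 0 ≤ (a : ℤ) * b + c := by linarith
        -- the second argument is the first plus `j*b` periods
        have harg : Int.toNat (((a + j * q : ℕ) : ℤ) * b + c) =
            Int.toNat ((a : ℤ) * b + c) + (j * b) * q := by
          have : ((a + j * q : ℕ) : ℤ) * b + c = ((a : ℤ) * b + c) + ((j * b * q : ℕ) : ℤ) := by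
            push_cast; ring
          rw [this, Int.toNat_add_nat h0]
        have hperJ : Function.Periodic f ((j * b) * q) := by
          have := hper.nat_mul (j * b)
          simpa using this
        rw [harg, hperJ, ← sq]
        apply hf
        intro hz
        rw [Int.toNat_eq_zero] at hz
        linarith
    _ = B := by simp

/-- LOWER BOUND: with rows `(m, 2m]`, `m = 4qn`, the pairs `(a, a + jq)` with `a ∈ (m, m+2qn]`,
`j < n` lie in the table and contribute `2qn · n · B²`; so `momentN ≥ 2qn²B²`. -/
theorem momentN_ge_of_periodic {q : ℕ} (hq : 1 ≤ q) (hper : Function.Periodic f q)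
    (hf : ∀ n, n ≠ 0 → f n ^ 2 = 1) {n B : ℕ} (hc : -c ≤ (4 * q * n : ℕ)) :
    (2 * q * n : ℕ) * n * (B : ℝ) ^ 2 ≤ momentN f c (4 * q * n) (2 * (4 * q * n)) B := by
  set m : ℕ := 4 * q * n with hm
  unfold momentN
  -- restrict the outer sum to `a ∈ (m, m + 2qn]`
  have hsub : Ioc m (m + 2 * q * n) ⊆ Ioc m (2 * m) := by
    intro a ha
    rw [mem_Ioc] at ha ⊢
    refine ⟨ha.1, ?_⟩
    have : m + 2 * q * n ≤ 2 * m := by rw [hm]; nlinarith [Nat.zero_le (q * n)]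
    omega
  have hpos : ∀ a ∈ Ioc m (2 * m), ∀ b ∈ Icc 1 B, 1 ≤ (a : ℤ) * b + c := by
    intro a ha b hb
    rw [mem_Ioc] at ha
    rw [mem_Icc] at hb
    have ha1 : (m : ℤ) + 1 ≤ a := by exact_mod_cast ha.1
    have hb1 : (1 : ℤ) ≤ b := by exact_mod_cast hb.1
    have hm0 : (0 : ℤ) ≤ m := by positivity
    have hcm : -c ≤ (m : ℤ) := by rw [hm]; exact hc
    nlinarith
  calc ((2 * q * n : ℕ) : ℝ) * n * (B : ℝ) ^ 2
      = ∑ _a ∈ Ioc m (m + 2 * q * n), ∑ _j ∈ range n, (B : ℝ) ^ 2 := by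
        rw [sum_const, sum_const, Nat.card_Ioc, card_range, Nat.add_sub_cancel_left]
        simp only [nsmul_eq_mul]
        push_cast
        ring
    _ = ∑ a ∈ Ioc m (m + 2 * q * n), ∑ j ∈ range n, rowCorr f c B a (a + j * q) ^ 2 := by
        refine sum_congr rfl fun a ha => sum_congr rfl fun j _ => ?_
        rw [rowCorr_eq_cols_of_periodic hper hf (hpos a (hsub ha))]
    _ = ∑ a ∈ Ioc m (m + 2 * q * n),
          ∑ a' ∈ (range n).image (fun j => a + j * q), rowCorr f c B a a' ^ 2 := by
        refine sum_congr rfl fun a _ => ?_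
        rw [sum_image]
        intro j _ j' _ hjj'
        have h' : a + j * q = a + j' * q := hjj'
        have h2 : j * q = j' * q := Nat.add_left_cancel h'
        exact Nat.eq_of_mul_eq_mul_right hq h2
    _ ≤ ∑ a ∈ Ioc m (m + 2 * q * n), ∑ a' ∈ Ioc m (2 * m), rowCorr f c B a a' ^ 2 := by
        refine sum_le_sum fun a ha => ?_
        refine sum_le_sum_of_subset_of_nonneg ?_ (fun _ _ _ => sq_nonneg _)
        intro a' ha'
        rw [mem_image] at ha'
        obtain ⟨j, hj, rfl⟩ := ha'
        rw [mem_range] at hj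
        rw [mem_Ioc] at ha ⊢
        refine ⟨by omega, ?_⟩
        have h1 : j * q + q ≤ n * q := by
          calc j * q + q = (j + 1) * q := by ring
            _ ≤ n * q := Nat.mul_le_mul_right q (Nat.succ_le_of_lt hj)
        have h3 : m + 2 * q * n + n * q ≤ 2 * m := by rw [hm]; nlinarith [Nat.zero_le (q * n)]
        have ha2 : a ≤ m + 2 * q * n := ha.2
        linarith
    _ ≤ ∑ a ∈ Ioc m (2 * m), ∑ a' ∈ Ioc m (2 * m), rowCorr f c B a a' ^ 2 :=
        sum_le_sum_of_subset_of_nonneg hsub (fun _ _ _ => sum_nonneg fun _ _ => sq_nonneg _)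

/-- `(log x)^C` is eventually as large as we please. -/
theorem eventually_le_log_rpow {C : ℝ} (hC : 0 < C) (M : ℝ) :
    ∃ X : ℝ, ∀ x : ℝ, X ≤ x → M ≤ Real.log x ^ C := by
  have h := ((tendsto_rpow_atTop hC).comp Real.tendsto_log_atTop).eventually (Filter.eventually_ge_atTop M)
  rw [Filter.eventually_atTop] at h
  obtain ⟨X, hX⟩ := h
  exact ⟨X, fun x hx => hX x hx⟩

/-- MAIN: a `q`-periodic `±1`-valued symbol violates the crux's bound at EVERY parameter point
`(c, δ, C)` with `0 < δ ≤ 1/12`, `0 < C` (any shift `c : ℤ`). At `x = m¹²`, `A = m = 4qn`: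
`x²/(8q) ≤ T ≤ x²/(log x)^C` is absurd once `(log x)^C > 8q`. -/
theorem not_tableChowlaBoundAt_of_periodic {q : ℕ} (hq : 1 ≤ q) (hper : Function.Periodic f q)
    (hf : ∀ n, n ≠ 0 → f n ^ 2 = 1) (c : ℤ) {δ : ℝ} (hδ : 0 < δ) (hδ' : δ ≤ 1 / 12) {C : ℝ}
    (hC : 0 < C) : ¬ TableChowlaBoundAt f c δ C := by
  rintro ⟨x₀, hx₀⟩
  obtain ⟨X, hX⟩ := eventually_le_log_rpow hC (8 * q + 1)
  obtain ⟨n, hn⟩ := exists_nat_ge (max (max x₀ X) (max ((Int.natAbs c : ℕ) : ℝ) 1))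
  have hnx₀ : x₀ ≤ n := le_trans (le_trans (le_max_left _ _) (le_max_left _ _)) hn
  have hnX : X ≤ n := le_trans (le_trans (le_max_right _ _) (le_max_left _ _)) hn
  have hnc : ((Int.natAbs c : ℕ) : ℝ) ≤ n := le_trans (le_trans (le_max_left _ _) (le_max_right _ _)) hn
  have hn1 : (1 : ℝ) ≤ n := le_trans (le_trans (le_max_right _ _) (le_max_right _ _)) hn
  have hn1' : 1 ≤ n := by exact_mod_cast hn1
  set m : ℕ := 4 * q * n with hm
  have hmn : n ≤ m := by rw [hm]; nlinarith [hq, Nat.zero_le (q * n)]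
  have hmn' : (n : ℝ) ≤ m := by exact_mod_cast hmn
  have hm1 : (1 : ℝ) ≤ m := le_trans hn1 hmn'
  have hm1' : 1 ≤ m := by exact_mod_cast hm1
  have hm0 : m ≠ 0 := by omega
  have hmpos : (0 : ℝ) < m := by linarith
  -- the scale `x = m ^ 12` and the row parameter `A = m`
  have hx1 : (1 : ℝ) ≤ (m : ℝ) ^ 12 := one_le_pow₀ hm1
  have hxm : (m : ℝ) ≤ (m : ℝ) ^ 12 := le_self_pow₀ hm1 (by norm_num)
  have hxx₀ : x₀ ≤ (m : ℝ) ^ 12 := hnx₀.trans (hmn'.trans hxm)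
  have hxX : X ≤ (m : ℝ) ^ 12 := hnX.trans (hmn'.trans hxm)
  have hA : (m : ℝ) = ((m : ℝ) ^ 12) ^ ((1 : ℝ) / 12) := by
    rw [show ((1 : ℝ) / 12) = (1 : ℝ) / (12 : ℕ) by norm_num]
    exact (rpow_pow_one_div 12 (by norm_num) m).symm
  have hw1 : ((m : ℝ) ^ 12) ^ δ ≤ m :=
    calc ((m : ℝ) ^ 12) ^ δ ≤ ((m : ℝ) ^ 12) ^ ((1 : ℝ) / 12) :=
          Real.rpow_le_rpow_of_exponent_le hx1 hδ'
      _ = m := hA.symm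
  have hw2 : (m : ℝ) ≤ ((m : ℝ) ^ 12) ^ (1 / 3 + δ) :=
    calc (m : ℝ) = ((m : ℝ) ^ 12) ^ ((1 : ℝ) / 12) := hA
      _ ≤ ((m : ℝ) ^ 12) ^ (1 / 3 + δ) := Real.rpow_le_rpow_of_exponent_le hx1 (by linarith)
  have key := hx₀ ((m : ℝ) ^ 12) hxx₀ m hw1 hw2
  rw [moment_pow f c (by norm_num) hm0, Real.log_pow] at key
  -- lower bound `2 q n² B² ≤ T`, `B = m¹¹`
  have hcm : -c ≤ ((4 * q * n : ℕ) : ℤ) := by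
    have h1 : -c ≤ (Int.natAbs c : ℤ) := by
      have h := (Int.le_natAbs : -c ≤ ((-c).natAbs : ℤ))
      rwa [Int.natAbs_neg] at h
    have h2 : ((Int.natAbs c : ℕ) : ℤ) ≤ (n : ℤ) := by exact_mod_cast (show (Int.natAbs c) ≤ n by exact_mod_cast hnc)
    have h3 : (n : ℤ) ≤ ((4 * q * n : ℕ) : ℤ) := by exact_mod_cast hmn
    linarith
  have hlow := momentN_ge_of_periodic hq hper hf (B := m ^ (12 - 1)) hcm
  rw [← hm] at hlow
  have hT := le_trans hlow key
  -- numerics: `2qn·n·(m¹¹)² = m²⁴/(8q)` since `m = 4qn`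
  have hmR : (m : ℝ) = 4 * q * n := by rw [hm]; push_cast; ring
  have hP : (0 : ℝ) < ((2 * q * n : ℕ) : ℝ) * n * ((m ^ (12 - 1) : ℕ) : ℝ) ^ 2 := by
    have hq' : (0 : ℝ) < q := by exact_mod_cast hq
    have hn' : (0 : ℝ) < n := by linarith
    push_cast
    positivity
  refine absurd_of_le_div hP (κ := 8 * q) (le_of_eq ?_) (by positivity) ?_ hT
  · push_cast
    rw [hmR]
    ring
  · have := hX _ hxX
    rw [Real.log_pow] at this
    push_cast at this ⊢
    linarith

/-- In particular `TableChowlaFor f` fails for every periodic `±1`-valued symbol (at `c = 1`,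
`δ = 1/12`, `C = 1`, say) — superseding `not_tableChowlaFor_one`. -/
theorem not_tableChowlaFor_of_periodic {q : ℕ} (hq : 1 ≤ q) (hper : Function.Periodic f q)
    (hf : ∀ n, n ≠ 0 → f n ^ 2 = 1) : ¬ TableChowlaFor f := fun h =>
  not_tableChowlaBoundAt_of_periodic hq hper hf 1 (by norm_num : (0 : ℝ) < 1 / 12) le_rfl one_pos
    (h 1 one_ne_zero (1 / 12) (by norm_num) le_rfl 1 one_pos)

/-- `f ≡ 1` re-derived (period 1). -/
example : ¬ TableChowlaFor (fun _ => 1) :=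
  not_tableChowlaFor_of_periodic (q := 1) le_rfl (fun _ => rfl) (fun _ _ => by norm_num)

/-- The alternating symbol `(-1)^n` (period 2) fails too, at every shift. -/
example (c : ℤ) {C : ℝ} (hC : 0 < C) :
    ¬ TableChowlaBoundAt (fun n => (-1 : ℝ) ^ n) c (1 / 12) C :=
  not_tableChowlaBoundAt_of_periodic (q := 2) (by norm_num)
    (fun n => by simp [pow_add]) (fun n _ => by rw [← pow_mul, mul_comm, pow_mul]; norm_num)
    c (by norm_num) le_rfl hC

/-- The COMPLETED character `χ₄⁺` (`χ₄` on odd `n`, `+1` on even `n`): 4-periodic, `±1`-valued,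
"pretends" to be `χ₄`. -/
def chi4plus (n : ℕ) : ℝ := if n % 4 = 3 then -1 else 1

/-- `χ₄⁺` is 4-periodic. -/
theorem chi4plus_periodic : Function.Periodic chi4plus 4 := fun n => by
  simp [chi4plus, Nat.add_mod_right]

/-- `χ₄⁺` is `±1`-valued. -/
theorem chi4plus_sq (n : ℕ) : chi4plus n ^ 2 = 1 := by
  unfold chi4plus; split_ifs <;> norm_num

/-- `χ₄⁺ = χ₄` on odd integers. -/
theorem chi4plus_eq_chi4_of_odd {n : ℕ} (hn : n % 2 = 1) : chi4plus n = chi4 n := by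
  have h4 : n % 4 = 1 ∨ n % 4 = 3 := by omega
  unfold chi4plus chi4
  rcases h4 with h | h <;> simp [h]

/-- … and it violates the crux's bound at EVERY shift `c` (not only `c = 4` as in
`not_tableChowlaFor_chi4`), every `δ ∈ (0,1/12]`, every `C > 0`. -/
theorem not_tableChowlaBoundAt_chi4plus (c : ℤ) {δ : ℝ} (hδ : 0 < δ) (hδ' : δ ≤ 1 / 12) {C : ℝ}
    (hC : 0 < C) : ¬ TableChowlaBoundAt chi4plus c δ C :=
  not_tableChowlaBoundAt_of_periodic (q := 4) (by norm_num) chi4plus_periodic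
    (fun n _ => chi4plus_sq n) c hδ hδ' hC

/-- READ-BACK for `λ`: the crux is `∀ c ≠ 0, ∀ δ ∈ (0,1/12], ∀ C > 0, TableChowlaBoundAt λ c δ C`. -/
theorem tableChowla_iff_boundAt :
    LiouvilleShiftedTables.TableChowla ↔ ∀ c : ℤ, c ≠ 0 → ∀ δ : ℝ, 0 < δ → δ ≤ 1 / 12 →
      ∀ C : ℝ, 0 < C → TableChowlaBoundAt lam c δ C :=
  Iff.rfl

end

end Summit.Parity.GeneralizedHardyLittlewood.Theorems.TableChowla.Negative
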